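import Summits.CriticalPhenomena.CardyFormulaZ2.Theses.CardyBondTriangular
import Summits.CriticalPhenomena.CardyFormulaZ2.Theorems.CardyBondTriangularSwitchingReductionFromSwitching
import Summits.CriticalPhenomena.CardyFormulaZ2.Theorems.CardyBondTriangularSeparatingDataToCardy
import Summits.CriticalPhenomena.CardyFormulaZ2.Theorems.CardyBondTriangularBondTriangularCardyWeakAssembly
import Summits.CriticalPhenomena.CardyFormulaZ2.Theorems.CardyBondTriangularBondTriangularCardyStubThreeArmSmall
import Summits.CriticalPhenomena.CardyFormulaZ2.Theorems.CardyBondTriangularBondTriangularCardyStubWeakBoundaryUpgrade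
import Summits.CriticalPhenomena.CardyFormulaZ2.Theorems.CardyBondTriangularBondTriangularCardyStubOfAnticlockwise
import Summits.CriticalPhenomena.CardyFormulaZ2.Theorems.CardyBondTriangularBondTriangularCardyEquicontinuityOfBlueArm
import Summits.CriticalPhenomena.CardyFormulaZ2.Theorems.CardyBondTriangularBondTriangularCardyStubSeparatesOfIsPath
import Summits.CriticalPhenomena.CardyFormulaZ2.Theorems.CardyBondTriangularBondTriangularCardyStubCorner
import Summits.CriticalPhenomena.CardyFormulaZ2.Theorems.CardyBondTriangularBondTriangularCardyStubClDuality
import Summits.CriticalPhenomena.CardyFormulaZ2.Theorems.CardyBondTriangularBondTriangularCardyStubBlueArm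
import Summits.CriticalPhenomena.CardyFormulaZ2.Theorems.CardyBondTriangularBondTriangularCardyUpperOfCofill
import Summits.CriticalPhenomena.CardyFormulaZ2.Theorems.CardyBondTriangularBondTriangularCardyStubCofillGeometry
import Summits.CriticalPhenomena.CardyFormulaZ2.Theorems.CardyBondTriangularBondTriangularCardyStubYellowCrossingOfCrude
import HarnessLib

/-!
# Crux `BondTriangularCardy`, line `birth`: Cardy's formula for critical bond-`𝕋` from the
colour-switching crux and RSW alone (kernel-checked composition of the whole line)

Lead file of the line `birth` of crux stmt-CriticalPhenomena-4664. It records, as a theorem of the tree,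
the END STATE of the registered skeleton `Lines/birth.lean` (v6, every stub but the crux's own open
content landed): Cardy's formula for critical bond percolation on `𝕋` (`BondTriangularCardy`, BY NAME)
follows from

* the route's rank-2 crux `MesoscopicColourSwitching` (stmt-CriticalPhenomena-5003, open in print:
  Bollobás–Riordan's colour switching (14) with a mesoscopic summed defect for the Chayes–Lei
  separating probabilities of critical bond-`𝕋`) BY NAME;
* the route item `BondTriangularBoxCrossing` (stmt-CriticalPhenomena-7023, RSW for bond-`𝕋`,
  Grimmett–Manolescu 2013) BY NAME;

everything else being LANDED: `stub_threeArmSmall` (p151159), `stub_weakBoundaryUpgrade` (p151132),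
`stub_ofAnticlockwise` (p151235), `stub_separatesOfIsPath` (p154664), `stub_corner` (p155664),
`stub_clDuality` (p158481), `stub_blueArm` (p159275), `stub_cofillGeometry` (p160657),
`stub_yellowCrossingOfCrude` (p160637), `equicontinuity_of_blueArm` (p152426),
`clYellowAnnulus_small_of_boxCrossing` (p151986), `discreteDomains_of_cofill` (p159486),
`exists_separatingData_triBond_of_mesoscopicColourSwitching_weak` (p149652) and
`separatingDataToCardy_proof` (item `SeparatingDataToCardy`). The proof is the composition
`BondTriangularCardy_of` of the skeleton: Bollobás–Riordan's proof of Smirnov's theorem (Ch. 7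
§7.2.4–7.2.6) run on the Chayes–Lei hexagon packaging of bond-`𝕋` — discrete approximations by inner
approximations of collar domains with cofill (Lemma 14), weak boundary values + corner normalisation +
the analytic sum-to-one upgrade, the sandwich (19)/(40) (lower half by containment, upper half by the
deterministic containment in the cofilled `G⁺`), the three-arm smallness (12) and the equicontinuity of
p. 198 from RSW through one-arm bounds, Claim 10's blue arm and the Chayes–Lei duality lemma on the
kite tiling, and the contour-integral/Morera conclusion through the route's `SwitchingReduction` and
`SeparatingDataToCardy`; the only percolation estimate NOT derived from RSW is the colour-switching
step, which is exactly the hypothesis `MesoscopicColourSwitching`.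

References: B. Bollobás, O. Riordan, *Percolation*, CUP 2006, Ch. 7 §7.2.4–7.2.6; L. Chayes, H. K. Lei,
Rev. Math. Phys. 19 (2007) §2; G. Grimmett, I. Manolescu, Ann. Probab. 41 (2013) §1.3.
-/

noncomputable section

namespace Summit.CriticalPhenomena.CardyFormulaZ2.Theorems.BondTriangularCardyLine

open Set Filter Topology Metric
open Literature.Probability.Percolation Literature.Probability.RandomPlanarGeometry
open Literature.Probability.RandomPlanarGeometry.MarkedDomain
open Literature.Probability.LatticeModels
open Summit.CriticalPhenomena.CardyFormulaZ2.Theorems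

/-- **Cardy's formula for critical bond-`𝕋` from the colour-switching crux and RSW (kernel-checked
composition of the whole line `birth`).** Given Bollobás–Riordan's colour switching (14) with mesoscopic
summed defect for the Chayes–Lei separating probabilities (`MesoscopicColourSwitching`, the route's open
crux, stmt-CriticalPhenomena-5003) and the box-crossing property of critical bond-`𝕋`
(`BondTriangularBoxCrossing`, stmt-CriticalPhenomena-7023, Grimmett–Manolescu 2013), Cardy's formula
`BondTriangularCardy` (stmt-CriticalPhenomena-4664) holds: for an anticlockwise Carleson datum,
`discreteDomains_of_cofill stub_cofillGeometry stub_yellowCrossingOfCrude` gives the discrete approximations `G∓` with weak boundary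
values, the corner normalisation and the sandwich; `stub_threeArmSmall` and
`equicontinuity_of_blueArm stub_blueArm` the interior inputs; the weak assembly
`exists_separatingData_triBond_of_mesoscopicColourSwitching_weak` (with the landed analysis upgrade
`stub_weakBoundaryUpgrade`) the separating data; `stub_ofAnticlockwise` removes the orientation
hypothesis and `separatingDataToCardy_proof` concludes. -/
theorem bondTriangularCardy_of_switching :
    Summit.CriticalPhenomena.CardyFormulaZ2.Theses.CardyBondTriangular.MesoscopicColourSwitching →
    Summit.CriticalPhenomena.CardyFormulaZ2.Theses.CardyBondTriangular.BondTriangularBoxCrossing →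
    Summit.CriticalPhenomena.CardyFormulaZ2.Theses.CardyBondTriangular.BondTriangularCardy := by
  intro h14 hrsw
  have h12 := stub_threeArmSmall hrsw
  have h198 := equicontinuity_of_blueArm stub_blueArm hrsw
  have hdom : Sig.discreteDomains :=
    discreteDomains_of_cofill stub_cofillGeometry stub_yellowCrossingOfCrude clYellowAnnulus_small_of_boxCrossing
      (stub_corner stub_clDuality stub_separatesOfIsPath) hrsw
  refine separatingDataToCardy_proof (stub_ofAnticlockwise ?_)
  intro R a b c d ψ habc hd hψ hturn
  obtain ⟨Gm, Gp, hGm, hGp, h200m, hcm, h200p, hcp, zm, zp, e, hzm, hzp, hztm, hztp, he, hsand⟩ :=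
    hdom R a b c d ψ habc hd hψ hturn
  rw [hturn]
  exact exists_separatingData_triBond_of_mesoscopicColourSwitching_weak stub_weakBoundaryUpgrade h14 hGm hGp
    (h12 R Gm hGm) (h198 R Gm hGm) h200m hcm (h12 R Gp hGp) (h198 R Gp hGp) h200p hcp hzm hzp hztm hztp he hsand

end Summit.CriticalPhenomena.CardyFormulaZ2.Theorems.BondTriangularCardyLine

end
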